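import Summits.AnomalousDissipation.AnomalousDissipation.Theorems.StirringSphereEnsembleRealizationStubAugCurrentLevelMarg
import Summits.AnomalousDissipation.AnomalousDissipation.Theorems.MomentParityPathField

/-!
# Crux `EnsembleRealization` (stmt-AnomalousDissipation-0215) — line `augmented-lift`,
# sub-stub (M1a) `stub_augCurrentLevelPairs`, piece (L5)/EnergyGap: pointwise tools for the energy link

Supports stmt-AnomalousDissipation-0215 (stub `stub_augCurrentLevelPairs` of line
`augmented-lift`, piece L5 `stub_augCurrentLevelLinkTools`, ENERGY part of step (A6) of
`augCurrent-notes.md` §3; consumed by `stub_augCurrentLevelEnergyTools`). Nothing here closes an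
item. Theorems only.

For one level of `stub_augCurrentLevelPairs` (an orthonormal smooth family `gⱼ` complete for `P_N`,
`θ ∈ [0, 1]` with `(1 − θ) R ≤ δ ≤ 1`, the one-sided product mollifier `ρ₁ ⊗ ρ₂` of width `δ` and
the level kernel `κ_z(u) = ρ₁(z.1 − Z u) ρ₂(z.2 − ‖u‖²)`) and the level observable
`S(z) = ν · 4π² Σ_{k∈T} |k|² ‖𝓕(θ Σ zⱼ gⱼ)(k)‖² − (f, θ Σ zⱼ gⱼ)` (truncated dissipation minus work
of the synthesized field) this file proves:
* `energyCurrent_le`: the CEI bound `J_e + 2 ∫ κ (ν‖u‖_V² − (u, f)) dμ ≤ 0` gives `J_e ≤ 2 ‖f‖₂ R ∫ κ`;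
* `level_gap_le`: the POINTWISE GAP `S(z) − (ν‖u‖_V² − (u, f)) ≤ η` for `u` in the ball `‖u‖ ≤ R`
  with finite enstrophy and `θ ‖z.1 − Z u‖ ≤ δ`, with
  `η = ν 4π² (Σ_{k∈T} |k|²)(2R + 1) δ + 2 ‖f‖₂ δ + R ‖P_N f − f‖₂` (modes of the shifted synthesized
  field `θ 𝓕(P_N u)(k) + O(δ)`, `mFourierCoeff_synth_shift`; the work through the symmetry of `P_N`,
  `integral_inner_fourierTruncate_comm`, and Cauchy–Schwarz);
* `level_sup_le`: the box bound `|S(z)| ≤ ν 4π² (Σ|k|²) R² + ‖f‖₂ R` for `θ ‖z.1‖ ≤ R`;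
* `stub_augCurrentLevelEnergyGapTools`: the kernel forms `S(z) ∫ κ_z − ∫ κ_z D ≤ η ∫ κ_z`
  (`μ`-a.e. `u` lies in the ball and has finite enstrophy) and `J_e ≤ 2 ‖f‖₂ R ∫ κ_z`.
-/

noncomputable section

set_option linter.dupNamespace false

open MeasureTheory Set Filter Topology Function Metric UnitAddTorus
open scoped BigOperators ENNReal InnerProductSpace RealInnerProductSpace

namespace Summit.AnomalousDissipation.AnomalousDissipation.Theorems.EnsembleRealization

open Literature.Analysis.FunctionSpaces Literature.Analysis.FunctionSpaces.Torus
open Literature.Analysis.FluidPDE Literature.Analysis.FluidPDE.Torus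

/-! ### The energy current -/

/-- **Upper bound of the energy current**: from the CEI inequality
`J_e + 2 ∫ κ(u) (ν‖u‖_V² − (u, f)) dμ ≤ 0` with a weight `0 ≤ κ ≤ K`, `ν ≥ 0`, the a.e. ball
`‖u‖ ≤ R` and `|(u, f)| ≤ C_f ‖u‖`: `J_e ≤ 2 C_f R ∫ κ dμ` (the mollified measure `μ̃^κ` controls the
positive part of the energy current; used for the uniform part of the level law). -/
theorem energyCurrent_le {ν : ℝ} (hν : 0 ≤ ν) {f : UnitAddTorus (Fin 3) → EuclideanSpace ℝ (Fin 3)}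
    {μ : Measure (Torus.energySpace (Fin 3))} [IsFiniteMeasure μ] {R : ℝ} (hR : ∀ᵐ u ∂μ, ‖u‖ ≤ R)
    {Cf : ℝ} (hCf : 0 ≤ Cf) (hFb : ∀ u : Torus.energySpace (Fin 3), |pairing u.1 f| ≤ Cf * ‖u‖)
    (κ : Torus.energySpace (Fin 3) → ℝ) (hκ0 : ∀ u, 0 ≤ κ u) (hκm : AEStronglyMeasurable κ μ)
    {K : ℝ} (hκb : ∀ u, κ u ≤ K)
    (hint : Integrable (fun u : Torus.energySpace (Fin 3) =>
      κ u * (ν * (eGradNormSq (u.1 : UnitAddTorus (Fin 3) → EuclideanSpace ℝ (Fin 3))).toReal - pairing u.1 f)) μ)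
    {Je : ℝ} (hJe : Je + 2 * ∫ u, κ u *
      (ν * (eGradNormSq (u.1 : UnitAddTorus (Fin 3) → EuclideanSpace ℝ (Fin 3))).toReal - pairing u.1 f) ∂μ ≤ 0) :
    Je ≤ 2 * (Cf * R) * ∫ u, κ u ∂μ := by
  have hκi : Integrable κ μ := Integrable.of_bound hκm (C := K) (Eventually.of_forall fun u => by
    rw [Real.norm_eq_abs, abs_of_nonneg (hκ0 u)]; exact hκb u)
  have hle : ∫ u, -(κ u * (ν * (eGradNormSq (u.1 : UnitAddTorus (Fin 3) → EuclideanSpace ℝ (Fin 3))).toReal -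
      pairing u.1 f)) ∂μ ≤ ∫ u, Cf * R * κ u ∂μ := by
    refine integral_mono_ae hint.neg (hκi.const_mul _) (hR.mono fun u hu => ?_)
    have h1 : 0 ≤ ν * (eGradNormSq (u.1 : UnitAddTorus (Fin 3) → EuclideanSpace ℝ (Fin 3))).toReal :=
      mul_nonneg hν ENNReal.toReal_nonneg
    have h2 : pairing u.1 f ≤ Cf * R :=
      ((le_abs_self _).trans (hFb u)).trans (mul_le_mul_of_nonneg_left hu hCf)
    have h3 : -(κ u * (ν * (eGradNormSq (u.1 : UnitAddTorus (Fin 3) → EuclideanSpace ℝ (Fin 3))).toReal -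
        pairing u.1 f)) ≤ κ u * (Cf * R) := by
      rw [neg_mul_eq_mul_neg, neg_sub]
      exact mul_le_mul_of_nonneg_left (by linarith) (hκ0 u)
    linarith [mul_comm (κ u) (Cf * R)]
  rw [integral_neg, integral_const_mul] at hle
  linarith

/-! ### The pointwise gap -/

/-- The `L²` norm of the class of an `L²` field: `‖toLp a‖ = (∫ ‖a‖²)^{1/2}`. -/
theorem norm_toLp_eq_sqrt {a : UnitAddTorus (Fin 3) → EuclideanSpace ℝ (Fin 3)} (ha : MemLp a 2 volume) :
    ‖ha.toLp a‖ = Real.sqrt (∫ x, ‖a x‖ ^ 2) := by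
  rw [← Real.sqrt_sq (norm_nonneg _), ← integral_norm_sq_coe_eq]
  congr 1
  exact integral_congr_ae (ha.coeFn_toLp.mono fun x hx => by simp only [hx])

/-- `P_N` is symmetric on `L²`: `∫ ⟪a, P_N b⟫ = ∫ ⟪b, P_N a⟫`. -/
theorem integral_inner_fourierTruncate_comm {a b : UnitAddTorus (Fin 3) → EuclideanSpace ℝ (Fin 3)}
    (ha : MemLp a 2 volume) (hb : MemLp b 2 volume) (N : ℕ) :
    ∫ x, ⟪a x, fourierTruncate N b x⟫_ℝ = ∫ x, ⟪b x, fourierTruncate N a x⟫_ℝ := by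
  have h1 : ∀ c e : UnitAddTorus (Fin 3) → EuclideanSpace ℝ (Fin 3), MemLp c 2 volume → MemLp e 2 volume →
      ∫ x, ⟪c x, fourierTruncate N e x⟫_ℝ = ∑ k ∈ freqBall N,
        (⟪mFourierCoeff (EuclideanSpace.complexify ∘ e) k, mFourierCoeff (EuclideanSpace.complexify ∘ c) k⟫_ℂ).re := by
    intro c e hc he
    have h : (fun x => ⟪c x, fourierTruncate N e x⟫_ℝ) = fun x => ⟪fourierTruncate N e x, c x⟫_ℝ :=
      funext fun x => real_inner_comm _ _
    rw [h]
    exact integral_inner_fourierTruncate_left (he.integrable one_le_two) hc N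
  rw [h1 a b ha hb, h1 b a hb ha]
  exact Finset.sum_congr rfl fun k _ => by rw [← inner_conj_symm, Complex.conj_re]

/-- **Pointwise gap.** For `u` in the ball `‖u‖ ≤ R` with finite enstrophy, an orthonormal smooth
family complete for `P_N`, `0 ≤ θ ≤ 1` with `(1 − θ) R ≤ δ ≤ 1` and a coordinate vector `w` with
`θ ‖w − Z u‖ ≤ δ`: the truncated enstrophy of the synthesized field `θ Σ wⱼ gⱼ` exceeds `‖u‖_V²` by at
most `4π² (Σ_{k∈T} |k|²)(2R + 1) δ` (modes `θ 𝓕(P_N u)(k) + O(δ)`), and its work falls short of `(u, f)`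
by at most `2 ‖f‖₂ δ + R ‖P_N f − f‖₂` (`P_N` symmetric, Cauchy–Schwarz). -/
theorem level_gap_le {ν : ℝ} (hν : 0 < ν) {f : UnitAddTorus (Fin 3) → EuclideanSpace ℝ (Fin 3)}
    (hf : MemLp f 2 volume) {D : ℕ} {g : Fin D → UnitAddTorus (Fin 3) → EuclideanSpace ℝ (Fin 3)}
    (hg : ∀ j, IsSmooth (g j)) (horth : ∀ i j, ∫ x, ⟪g i x, g j x⟫_ℝ = if i = j then 1 else 0) {N : ℕ}
    (u : Torus.energySpace (Fin 3))
    (hgH : ∀ x, ∑ j, pairing u.1 (g j) • g j x = fourierTruncate N (u.1 : UnitAddTorus (Fin 3) → EuclideanSpace ℝ (Fin 3)) x)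
    (hfin : eGradNormSq (u.1 : UnitAddTorus (Fin 3) → EuclideanSpace ℝ (Fin 3)) ≠ ⊤)
    {θ δ R : ℝ} (hθ0 : 0 ≤ θ) (hθ1 : θ ≤ 1) (hθR : (1 - θ) * R ≤ δ) (hδ1 : δ ≤ 1) (hu : ‖u‖ ≤ R)
    (w : EuclideanSpace ℝ (Fin D)) (hw : θ * ‖w - WithLp.toLp 2 fun j => pairing u.1 (g j)‖ ≤ δ)
    (T : Finset (Fin 3 → ℤ)) :
    ν * (4 * Real.pi ^ 2 * ∑ k ∈ T, freqNormSq k *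
        ‖mFourierCoeff (EuclideanSpace.complexify ∘ fun x => θ • ∑ j, w j • g j x) k‖ ^ 2) -
      (∫ x, ⟪f x, θ • ∑ j, w j • g j x⟫_ℝ) -
      (ν * (eGradNormSq (u.1 : UnitAddTorus (Fin 3) → EuclideanSpace ℝ (Fin 3))).toReal - pairing u.1 f) ≤
    ν * (4 * Real.pi ^ 2 * (∑ k ∈ T, freqNormSq k) * ((2 * R + 1) * δ)) +
      (2 * Real.sqrt (∫ x, ‖f x‖ ^ 2) * δ + R * (eLpNorm (fourierTruncate N f - f) 2 volume).toReal) := by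
  obtain ⟨y, rfl⟩ : ∃ y, w = (WithLp.toLp 2 fun j => pairing u.1 (g j)) + y :=
    ⟨w - WithLp.toLp 2 fun j => pairing u.1 (g j), (add_sub_cancel _ _).symm⟩
  rw [add_sub_cancel_left] at hw
  have hδ0 : 0 ≤ δ := le_trans (mul_nonneg hθ0 (norm_nonneg _)) hw
  have hR0 : 0 ≤ R := (norm_nonneg _).trans hu
  have hCf : 0 ≤ Real.sqrt (∫ x, ‖f x‖ ^ 2) := Real.sqrt_nonneg _
  have huR : ∀ k, ‖mFourierCoeff (EuclideanSpace.complexify ∘ (u.1 : UnitAddTorus (Fin 3) → EuclideanSpace ℝ (Fin 3))) k‖ ≤ R :=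
    fun k => (norm_mFourierCoeff_complexify_coe_le u.1 k).trans hu
  -- (A) the modes
  have hk : ∀ k, ‖mFourierCoeff (EuclideanSpace.complexify ∘ fun x =>
      θ • ∑ j, ((WithLp.toLp 2 fun j => pairing u.1 (g j)) + y) j • g j x) k‖ ^ 2 ≤
      ‖mFourierCoeff (EuclideanSpace.complexify ∘ (u.1 : UnitAddTorus (Fin 3) → EuclideanSpace ℝ (Fin 3))) k‖ ^ 2 +
        (2 * R + 1) * δ := fun k => by
    obtain ⟨hΨ, hY⟩ := mFourierCoeff_synth_shift hg horth u hgH θ y k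
    rw [hΨ]
    rw [abs_of_nonneg hθ0] at hY
    have h1 : ‖θ • (if k ∈ freqBall N then
        mFourierCoeff (EuclideanSpace.complexify ∘ (u.1 : UnitAddTorus (Fin 3) → EuclideanSpace ℝ (Fin 3))) k else 0) +
        mFourierCoeff (EuclideanSpace.complexify ∘ fun x => θ • ∑ j, y j • g j x) k‖ ≤
        ‖mFourierCoeff (EuclideanSpace.complexify ∘ (u.1 : UnitAddTorus (Fin 3) → EuclideanSpace ℝ (Fin 3))) k‖ + δ := by
      refine (norm_add_le _ _).trans (add_le_add ?_ (hY.trans hw))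
      rw [norm_smul, Real.norm_eq_abs, abs_of_nonneg hθ0]
      split_ifs
      · exact mul_le_of_le_one_left (norm_nonneg _) hθ1
      · rw [norm_zero, mul_zero]; exact norm_nonneg _
    have h2 := pow_le_pow_left₀ (norm_nonneg _) h1 2
    nlinarith [mul_le_mul_of_nonneg_right (huR k) hδ0, mul_le_mul_of_nonneg_left hδ1 hδ0,
      norm_nonneg (mFourierCoeff (EuclideanSpace.complexify ∘ (u.1 : UnitAddTorus (Fin 3) → EuclideanSpace ℝ (Fin 3))) k)]
  have hA : 4 * Real.pi ^ 2 * ∑ k ∈ T, freqNormSq k * ‖mFourierCoeff (EuclideanSpace.complexify ∘ fun x =>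
      θ • ∑ j, ((WithLp.toLp 2 fun j => pairing u.1 (g j)) + y) j • g j x) k‖ ^ 2 ≤
      (eGradNormSq (u.1 : UnitAddTorus (Fin 3) → EuclideanSpace ℝ (Fin 3))).toReal +
        4 * Real.pi ^ 2 * (∑ k ∈ T, freqNormSq k) * ((2 * R + 1) * δ) := by
    have hsum : ∑ k ∈ T, freqNormSq k * ‖mFourierCoeff (EuclideanSpace.complexify ∘ fun x =>
        θ • ∑ j, ((WithLp.toLp 2 fun j => pairing u.1 (g j)) + y) j • g j x) k‖ ^ 2 ≤
        ∑ k ∈ T, freqNormSq k * ‖mFourierCoeff (EuclideanSpace.complexify ∘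
          (u.1 : UnitAddTorus (Fin 3) → EuclideanSpace ℝ (Fin 3))) k‖ ^ 2 + (∑ k ∈ T, freqNormSq k) * ((2 * R + 1) * δ) := by
      rw [Finset.sum_mul, ← Finset.sum_add_distrib]
      exact Finset.sum_le_sum fun k _ => by
        have h := mul_le_mul_of_nonneg_left (hk k) (freqNormSq_nonneg k)
        rwa [mul_add] at h
    have hE : 4 * Real.pi ^ 2 * ∑ k ∈ T, freqNormSq k * ‖mFourierCoeff (EuclideanSpace.complexify ∘
        (u.1 : UnitAddTorus (Fin 3) → EuclideanSpace ℝ (Fin 3))) k‖ ^ 2 ≤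
        (eGradNormSq (u.1 : UnitAddTorus (Fin 3) → EuclideanSpace ℝ (Fin 3))).toReal :=
      (ENNReal.ofReal_le_iff_le_toReal hfin).1 (MomentParity.ofReal_sum_freqNormSq_mul_norm_sq_le T _)
    have hπ : (0 : ℝ) ≤ 4 * Real.pi ^ 2 := by positivity
    calc 4 * Real.pi ^ 2 * ∑ k ∈ T, freqNormSq k * ‖mFourierCoeff (EuclideanSpace.complexify ∘ fun x =>
          θ • ∑ j, ((WithLp.toLp 2 fun j => pairing u.1 (g j)) + y) j • g j x) k‖ ^ 2
        ≤ 4 * Real.pi ^ 2 * (∑ k ∈ T, freqNormSq k * ‖mFourierCoeff (EuclideanSpace.complexify ∘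
          (u.1 : UnitAddTorus (Fin 3) → EuclideanSpace ℝ (Fin 3))) k‖ ^ 2 + (∑ k ∈ T, freqNormSq k) * ((2 * R + 1) * δ)) :=
          mul_le_mul_of_nonneg_left hsum hπ
      _ = 4 * Real.pi ^ 2 * ∑ k ∈ T, freqNormSq k * ‖mFourierCoeff (EuclideanSpace.complexify ∘
          (u.1 : UnitAddTorus (Fin 3) → EuclideanSpace ℝ (Fin 3))) k‖ ^ 2 +
          4 * Real.pi ^ 2 * (∑ k ∈ T, freqNormSq k) * ((2 * R + 1) * δ) := by ring
      _ ≤ _ := add_le_add hE le_rfl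
  -- (B) the work
  have hfield : ∀ x, θ • ∑ j, ((WithLp.toLp 2 fun j => pairing u.1 (g j)) + y) j • g j x =
      θ • fourierTruncate N (u.1 : UnitAddTorus (Fin 3) → EuclideanSpace ℝ (Fin 3)) x + θ • ∑ j, y j • g j x := fun x => by
    rw [← smul_add, ← hgH x, ← Finset.sum_add_distrib]
    congr 1
    exact Finset.sum_congr rfl fun j _ => by rw [PiLp.add_apply, PiLp.toLp_apply, add_smul]
  have hint1 : Integrable (fun x => ⟪f x, θ • fourierTruncate N (u.1 : UnitAddTorus (Fin 3) → EuclideanSpace ℝ (Fin 3)) x⟫_ℝ) volume :=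
    integrable_inner_of_continuous (hf.integrable one_le_two) ((continuous_fourierTruncate N _).const_smul θ)
  have hint2 : Integrable (fun x => ⟪f x, θ • ∑ j, y j • g j x⟫_ℝ) volume :=
    integrable_inner_of_continuous (hf.integrable one_le_two) (isSmooth_synth hg θ y).continuous
  have hW1 : ∫ x, ⟪f x, θ • fourierTruncate N (u.1 : UnitAddTorus (Fin 3) → EuclideanSpace ℝ (Fin 3)) x⟫_ℝ =
      θ * pairing u.1 (fourierTruncate N f) := by
    simp_rw [real_inner_smul_right]
    rw [integral_const_mul, integral_inner_fourierTruncate_comm hf (Lp.memLp u.1) N]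
    rfl
  have hW : ∫ x, ⟪f x, θ • ∑ j, ((WithLp.toLp 2 fun j => pairing u.1 (g j)) + y) j • g j x⟫_ℝ =
      θ * pairing u.1 (fourierTruncate N f) + ∫ x, ⟪f x, θ • ∑ j, y j • g j x⟫_ℝ := by
    simp_rw [hfield, inner_add_right]
    rw [integral_add hint1 hint2, hW1]
  have hPf : MemLp (fourierTruncate N f) 2 volume := memLp_fourierTruncate N f 2
  have hB1 : |pairing u.1 f - pairing u.1 (fourierTruncate N f)| ≤ R * (eLpNorm (fourierTruncate N f - f) 2 volume).toReal := by
    rw [pairing_eq_inner hf, pairing_eq_inner hPf, ← inner_sub_right, ← MemLp.toLp_sub, eLpNorm_sub_comm,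
      ← Lp.norm_toLp (f - fourierTruncate N f) (hf.sub hPf)]
    exact (abs_real_inner_le_norm _ _).trans (mul_le_mul_of_nonneg_right hu (norm_nonneg _))
  have hB2 : |pairing u.1 (fourierTruncate N f)| ≤ R * Real.sqrt (∫ x, ‖f x‖ ^ 2) := by
    refine (abs_pairing_coe_le hPf u).trans (mul_le_mul hu ?_ (norm_nonneg _) hR0)
    rw [norm_toLp_eq_sqrt hPf]
    exact Real.sqrt_le_sqrt (integral_norm_sq_fourierTruncate_le hf N)
  have hB3 : |∫ x, ⟪f x, θ • ∑ j, y j • g j x⟫_ℝ| ≤ Real.sqrt (∫ x, ‖f x‖ ^ 2) * δ := by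
    refine (MomentParity.abs_integral_inner_le_sqrt_mul_sqrt hf ((isSmooth_synth hg θ y).memLp 2)).trans
      (mul_le_mul_of_nonneg_left ?_ hCf)
    rw [integral_norm_sq_synth hg horth θ y, ← mul_pow, Real.sqrt_sq (mul_nonneg hθ0 (norm_nonneg _))]
    exact hw
  have h1 := (le_abs_self _).trans hB1
  have h2 : (1 - θ) * pairing u.1 (fourierTruncate N f) ≤ δ * Real.sqrt (∫ x, ‖f x‖ ^ 2) :=
    calc (1 - θ) * pairing u.1 (fourierTruncate N f) ≤ (1 - θ) * (R * Real.sqrt (∫ x, ‖f x‖ ^ 2)) :=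
          mul_le_mul_of_nonneg_left ((le_abs_self _).trans hB2) (by linarith)
      _ = (1 - θ) * R * Real.sqrt (∫ x, ‖f x‖ ^ 2) := by ring
      _ ≤ δ * Real.sqrt (∫ x, ‖f x‖ ^ 2) := mul_le_mul_of_nonneg_right hθR hCf
  have h3 := (neg_le_abs _).trans hB3
  have h4 := mul_le_mul_of_nonneg_left hA hν.le
  rw [hW]
  nlinarith [h1, h2, h3, h4]

/-- **Box bound.** For `0 ≤ θ` and `θ ‖w‖ ≤ R`:
`|ν 4π² Σ_{k∈T} |k|² ‖𝓕(θ Σ wⱼ gⱼ)(k)‖² − (f, θ Σ wⱼ gⱼ)| ≤ ν 4π² (Σ_{k∈T} |k|²) R² + ‖f‖₂ R` (Bessel and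
Cauchy–Schwarz for the synthesized field of energy `θ² ‖w‖² ≤ R²`). -/
theorem level_sup_le {ν : ℝ} (hν : 0 ≤ ν) {f : UnitAddTorus (Fin 3) → EuclideanSpace ℝ (Fin 3)}
    (hf : MemLp f 2 volume) {D : ℕ} {g : Fin D → UnitAddTorus (Fin 3) → EuclideanSpace ℝ (Fin 3)}
    (hg : ∀ j, IsSmooth (g j)) (horth : ∀ i j, ∫ x, ⟪g i x, g j x⟫_ℝ = if i = j then 1 else 0)
    {θ R : ℝ} (hθ0 : 0 ≤ θ) (w : EuclideanSpace ℝ (Fin D)) (hw : θ * ‖w‖ ≤ R) (T : Finset (Fin 3 → ℤ)) :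
    |ν * (4 * Real.pi ^ 2 * ∑ k ∈ T, freqNormSq k *
        ‖mFourierCoeff (EuclideanSpace.complexify ∘ fun x => θ • ∑ j, w j • g j x) k‖ ^ 2) -
      ∫ x, ⟪f x, θ • ∑ j, w j • g j x⟫_ℝ| ≤
    ν * (4 * Real.pi ^ 2 * (∑ k ∈ T, freqNormSq k) * R ^ 2) + Real.sqrt (∫ x, ‖f x‖ ^ 2) * R := by
  have hθw : 0 ≤ θ * ‖w‖ := mul_nonneg hθ0 (norm_nonneg _)
  have hk : ∀ k, ‖mFourierCoeff (EuclideanSpace.complexify ∘ fun x => θ • ∑ j, w j • g j x) k‖ ^ 2 ≤ R ^ 2 :=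
    fun k => by
    have h := sum_norm_sq_mFourierCoeff_synth_le hg horth θ w {k}
    rw [Finset.sum_singleton, ← mul_pow] at h
    exact h.trans (pow_le_pow_left₀ hθw hw 2)
  have hA0 : 0 ≤ ∑ k ∈ T, freqNormSq k *
      ‖mFourierCoeff (EuclideanSpace.complexify ∘ fun x => θ • ∑ j, w j • g j x) k‖ ^ 2 :=
    Finset.sum_nonneg fun k _ => mul_nonneg (freqNormSq_nonneg k) (sq_nonneg _)
  have hA : ∑ k ∈ T, freqNormSq k *
      ‖mFourierCoeff (EuclideanSpace.complexify ∘ fun x => θ • ∑ j, w j • g j x) k‖ ^ 2 ≤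
      (∑ k ∈ T, freqNormSq k) * R ^ 2 := by
    rw [Finset.sum_mul]
    exact Finset.sum_le_sum fun k _ => mul_le_mul_of_nonneg_left (hk k) (freqNormSq_nonneg k)
  have hWb : |∫ x, ⟪f x, θ • ∑ j, w j • g j x⟫_ℝ| ≤ Real.sqrt (∫ x, ‖f x‖ ^ 2) * R := by
    refine (MomentParity.abs_integral_inner_le_sqrt_mul_sqrt hf ((isSmooth_synth hg θ w).memLp 2)).trans
      (mul_le_mul_of_nonneg_left ?_ (Real.sqrt_nonneg _))
    rw [integral_norm_sq_synth hg horth θ w, ← mul_pow, Real.sqrt_sq hθw]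
    exact hw
  have hπ : (0 : ℝ) ≤ 4 * Real.pi ^ 2 := by positivity
  have h1 := mul_le_mul_of_nonneg_left (mul_le_mul_of_nonneg_left hA hπ) hν
  have h2 := mul_nonneg hν (mul_nonneg hπ hA0)
  have h3 : 0 ≤ ν * (4 * Real.pi ^ 2 * (∑ k ∈ T, freqNormSq k) * R ^ 2) :=
    mul_nonneg hν (mul_nonneg (mul_nonneg hπ (Finset.sum_nonneg fun k _ => freqNormSq_nonneg k)) (sq_nonneg _))
  rw [abs_le]
  constructor
  · nlinarith [(le_abs_self _).trans hWb]
  · nlinarith [(neg_le_abs _).trans hWb]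

/-! ### The packaged gap tools -/

/-- **Energy-gap tools for (M1a), piece (L5)/Energy**: the kernel form of the gap and of the
energy-current bound at one point `z`. With the level kernel `κ(u) = ρ₁(z.1 − Z u) ρ₂(z.2 − ‖u‖²)`
(`ρ₁` supported in `‖y‖ < δ`): `S(z) ∫ κ − ∫ κ D ≤ η ∫ κ` (from `level_gap_le`, `μ`-a.e. `u` in the
ball with finite enstrophy) and `J_e + 2 ∫ κ D ≤ 0 ⇒ J_e ≤ 2 ‖f‖₂ R ∫ κ` (`energyCurrent_le`). -/
theorem stub_augCurrentLevelEnergyGapTools {ν : ℝ} (hν : 0 < ν) {f : UnitAddTorus (Fin 3) → EuclideanSpace ℝ (Fin 3)}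
    (hf : MemLp f 2 volume) {μ : Measure (Torus.energySpace (Fin 3))} [IsFiniteMeasure μ] {R : ℝ}
    (hR : ∀ᵐ u ∂μ, ‖u‖ ≤ R)
    (hfinae : ∀ᵐ u : Torus.energySpace (Fin 3) ∂μ, eGradNormSq (u.1 : UnitAddTorus (Fin 3) → EuclideanSpace ℝ (Fin 3)) < ⊤)
    {D : ℕ} {g : Fin D → UnitAddTorus (Fin 3) → EuclideanSpace ℝ (Fin 3)} (hg : ∀ j, IsSmooth (g j))
    (horth : ∀ i j, ∫ x, ⟪g i x, g j x⟫_ℝ = if i = j then 1 else 0) {N : ℕ}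
    (hgH : ∀ (u : Torus.energySpace (Fin 3)) x, ∑ j, pairing u.1 (g j) • g j x =
      fourierTruncate N (u.1 : UnitAddTorus (Fin 3) → EuclideanSpace ℝ (Fin 3)) x)
    {θ δ : ℝ} (hθ0 : 0 ≤ θ) (hθ1 : θ ≤ 1) (hθR : (1 - θ) * R ≤ δ) (hδ1 : δ ≤ 1)
    {ρ₁ : EuclideanSpace ℝ (Fin D) → ℝ} {ρ₂ : ℝ → ℝ}
    (hρ₁ : Continuous ρ₁ ∧ (∀ y, 0 ≤ ρ₁ y) ∧ (∀ y, δ ≤ ‖y‖ → ρ₁ y = 0) ∧ ∫ y, ρ₁ y = 1)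
    (hρ₂ : Continuous ρ₂ ∧ (∀ s, 0 ≤ ρ₂ s) ∧ (∀ s, s ∉ Ioo 0 δ → ρ₂ s = 0) ∧ ∫ s, ρ₂ s = 1)
    (T : Finset (Fin 3 → ℤ)) (z : EuclideanSpace ℝ (Fin D) × ℝ)
    (hJi : Integrable (fun u : Torus.energySpace (Fin 3) =>
      ρ₁ (z.1 - WithLp.toLp 2 fun j => pairing u.1 (g j)) * ρ₂ (z.2 - ‖u‖ ^ 2) *
        (ν * (eGradNormSq (u.1 : UnitAddTorus (Fin 3) → EuclideanSpace ℝ (Fin 3))).toReal - pairing u.1 f)) μ) :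
    ((ν * (4 * Real.pi ^ 2 * ∑ k ∈ T, freqNormSq k *
          ‖mFourierCoeff (EuclideanSpace.complexify ∘ fun x => θ • ∑ j, z.1 j • g j x) k‖ ^ 2) -
        ∫ x, ⟪f x, θ • ∑ j, z.1 j • g j x⟫_ℝ) *
        (∫ u, ρ₁ (z.1 - WithLp.toLp 2 fun j => pairing u.1 (g j)) * ρ₂ (z.2 - ‖u‖ ^ 2) ∂μ) -
      ∫ u, ρ₁ (z.1 - WithLp.toLp 2 fun j => pairing u.1 (g j)) * ρ₂ (z.2 - ‖u‖ ^ 2) *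
        (ν * (eGradNormSq (u.1 : UnitAddTorus (Fin 3) → EuclideanSpace ℝ (Fin 3))).toReal - pairing u.1 f) ∂μ ≤
      (ν * (4 * Real.pi ^ 2 * (∑ k ∈ T, freqNormSq k) * ((2 * R + 1) * δ)) +
        (2 * Real.sqrt (∫ x, ‖f x‖ ^ 2) * δ + R * (eLpNorm (fourierTruncate N f - f) 2 volume).toReal)) *
        ∫ u, ρ₁ (z.1 - WithLp.toLp 2 fun j => pairing u.1 (g j)) * ρ₂ (z.2 - ‖u‖ ^ 2) ∂μ) ∧
    ∀ Je : ℝ, Je + 2 * ∫ u, ρ₁ (z.1 - WithLp.toLp 2 fun j => pairing u.1 (g j)) * ρ₂ (z.2 - ‖u‖ ^ 2) *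
        (ν * (eGradNormSq (u.1 : UnitAddTorus (Fin 3) → EuclideanSpace ℝ (Fin 3))).toReal - pairing u.1 f) ∂μ ≤ 0 →
      Je ≤ 2 * (Real.sqrt (∫ x, ‖f x‖ ^ 2) * R) *
        ∫ u, ρ₁ (z.1 - WithLp.toLp 2 fun j => pairing u.1 (g j)) * ρ₂ (z.2 - ‖u‖ ^ 2) ∂μ := by
  obtain ⟨hρ₁c, hρ₁0, hρ₁δ, -⟩ := hρ₁
  obtain ⟨hρ₂c, hρ₂0, hρ₂δ, -⟩ := hρ₂
  -- the kernel: continuous, nonnegative, bounded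
  have hκc : Continuous fun u : Torus.energySpace (Fin 3) =>
      ρ₁ (z.1 - WithLp.toLp 2 fun j => pairing u.1 (g j)) * ρ₂ (z.2 - ‖u‖ ^ 2) :=
    (hρ₁c.comp (continuous_const.sub ((PiLp.continuous_toLp 2 _).comp
      (continuous_pi fun j => continuous_pairing_coe ((hg j).memLp 2))))).mul
      (hρ₂c.comp (continuous_const.sub (continuous_norm.pow 2)))
  have hκ0 : ∀ u : Torus.energySpace (Fin 3),
      0 ≤ ρ₁ (z.1 - WithLp.toLp 2 fun j => pairing u.1 (g j)) * ρ₂ (z.2 - ‖u‖ ^ 2) :=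
    fun u => mul_nonneg (hρ₁0 _) (hρ₂0 _)
  obtain ⟨B₁, hB₁⟩ := hρ₁c.bounded_above_of_compact_support (HasCompactSupport.intro
    (isCompact_closedBall (0 : EuclideanSpace ℝ (Fin D)) δ) fun y hy =>
      hρ₁δ y (not_lt.1 fun h => hy (mem_closedBall_zero_iff.2 h.le)))
  obtain ⟨B₂, hB₂⟩ := hρ₂c.bounded_above_of_compact_support (HasCompactSupport.intro (K := Icc 0 δ)
    isCompact_Icc fun s hs => hρ₂δ s fun h => hs (Ioo_subset_Icc_self h))
  have hκb : ∀ u : Torus.energySpace (Fin 3),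
      ρ₁ (z.1 - WithLp.toLp 2 fun j => pairing u.1 (g j)) * ρ₂ (z.2 - ‖u‖ ^ 2) ≤ B₁ * B₂ := fun u => by
    refine (Real.le_norm_self _).trans ?_
    rw [norm_mul]
    exact mul_le_mul (hB₁ _) (hB₂ _) (norm_nonneg _) ((norm_nonneg _).trans (hB₁ 0))
  have hκi : Integrable (fun u : Torus.energySpace (Fin 3) =>
      ρ₁ (z.1 - WithLp.toLp 2 fun j => pairing u.1 (g j)) * ρ₂ (z.2 - ‖u‖ ^ 2)) μ :=
    Integrable.of_bound hκc.aestronglyMeasurable (B₁ * B₂) (Eventually.of_forall fun u => by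
      rw [Real.norm_of_nonneg (hκ0 u)]; exact hκb u)
  have hCf : ∀ u : Torus.energySpace (Fin 3), |pairing u.1 f| ≤ Real.sqrt (∫ x, ‖f x‖ ^ 2) * ‖u‖ := fun u => by
    rw [← norm_toLp_eq_sqrt hf, mul_comm]; exact abs_pairing_coe_le hf u
  refine ⟨?_, fun Je hJe => energyCurrent_le hν.le hR (Real.sqrt_nonneg _) hCf _ hκ0
    hκc.aestronglyMeasurable hκb hJi hJe⟩
  -- the gap, integrated against the kernel
  have hae : ∀ᵐ u : Torus.energySpace (Fin 3) ∂μ,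
      ρ₁ (z.1 - WithLp.toLp 2 fun j => pairing u.1 (g j)) * ρ₂ (z.2 - ‖u‖ ^ 2) *
        ((ν * (4 * Real.pi ^ 2 * ∑ k ∈ T, freqNormSq k *
            ‖mFourierCoeff (EuclideanSpace.complexify ∘ fun x => θ • ∑ j, z.1 j • g j x) k‖ ^ 2) -
          ∫ x, ⟪f x, θ • ∑ j, z.1 j • g j x⟫_ℝ) -
          (ν * (eGradNormSq (u.1 : UnitAddTorus (Fin 3) → EuclideanSpace ℝ (Fin 3))).toReal - pairing u.1 f) -
          (ν * (4 * Real.pi ^ 2 * (∑ k ∈ T, freqNormSq k) * ((2 * R + 1) * δ)) +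
            (2 * Real.sqrt (∫ x, ‖f x‖ ^ 2) * δ + R * (eLpNorm (fourierTruncate N f - f) 2 volume).toReal))) ≤ 0 := by
    filter_upwards [hR, hfinae] with u hu hfin
    by_cases hκz : ρ₁ (z.1 - WithLp.toLp 2 fun j => pairing u.1 (g j)) * ρ₂ (z.2 - ‖u‖ ^ 2) = 0
    · rw [hκz, zero_mul]
    · refine mul_nonpos_of_nonneg_of_nonpos (hκ0 u) ?_
      have hy : ‖z.1 - WithLp.toLp 2 fun j => pairing u.1 (g j)‖ < δ :=
        not_le.1 fun h => hκz (by rw [hρ₁δ _ h, zero_mul])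
      have hw : θ * ‖z.1 - WithLp.toLp 2 fun j => pairing u.1 (g j)‖ ≤ δ :=
        (mul_le_of_le_one_left (norm_nonneg _) hθ1).trans hy.le
      linarith [level_gap_le hν hf hg horth u (hgH u) hfin.ne hθ0 hθ1 hθR hδ1 hu z.1 hw T]
  have hint := integral_nonpos_of_ae hae
  have hsplit : ∀ (S η : ℝ), ∫ u, ρ₁ (z.1 - WithLp.toLp 2 fun j => pairing u.1 (g j)) * ρ₂ (z.2 - ‖u‖ ^ 2) *
      (S - (ν * (eGradNormSq (u.1 : UnitAddTorus (Fin 3) → EuclideanSpace ℝ (Fin 3))).toReal - pairing u.1 f) - η) ∂μ =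
      (S - η) * (∫ u, ρ₁ (z.1 - WithLp.toLp 2 fun j => pairing u.1 (g j)) * ρ₂ (z.2 - ‖u‖ ^ 2) ∂μ) -
        ∫ u, ρ₁ (z.1 - WithLp.toLp 2 fun j => pairing u.1 (g j)) * ρ₂ (z.2 - ‖u‖ ^ 2) *
          (ν * (eGradNormSq (u.1 : UnitAddTorus (Fin 3) → EuclideanSpace ℝ (Fin 3))).toReal - pairing u.1 f) ∂μ := by
    intro S η
    rw [← integral_const_mul, ← integral_sub (hκi.const_mul _) hJi]
    exact integral_congr_ae (Eventually.of_forall fun u => by ring)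
  rw [hsplit] at hint
  linarith

end Summit.AnomalousDissipation.AnomalousDissipation.Theorems.EnsembleRealization
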